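import Summits.HubbardSuperconductivity.HubbardSuperconductivity.Theorems.FunctionFieldCertificateAssemblyFejerGlue
import Summits.HubbardSuperconductivity.HubbardSuperconductivity.Theorems.FunctionFieldCertificateWindowInfraredBoundReductions
import Literature.MathematicalPhysics.QuantumLattice.BlockPairPlancherel
import Literature.Probability.LatticeModels.BoxKernelBounds
import HarnessLib

/-!
# Crux `MesoscopicPairOrder` (stmt-HubbardSuperconductivity-7331) IS a uniform infrared pair-weight floor

Supports item `stmt-HubbardSuperconductivity-7331` of route `FunctionFieldCertificate` (pole-free crux:
at one `(U, δ)` a margin `m R² ≤ T_R(ψ)/L²` for the Fejér-box pair functional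
`T_R(ψ) = Σ_{x,y} Πᵢ (1 - |(y - x)ᵢ|_L/R)₊ Re⟨P_x ψ, P_y ψ⟩`, `P_x = localPair dWaveFormFactor L x`, at
arbitrarily large scales `R`, in EVERY normalised `(N_L, S^z = 0)`-sector ground state). The crux is open
physics and is not settled here. This file restates it, by a theorem, in the MOMENTUM language of the
route's other crux `WindowInfraredBound` (stmt-1089) — the pair structure factor
`S_ψ(m) = ‖Δ_d(m)ψ‖²/L²` (`pairStructureFactor`) and the infrared windows `|q_m|² ≤ ε²`
(`momentumNormSq L m ≤ ε²`):

* `sq_mul_boxSum_eq_sum_boxKernel_mul_pairStructureFactor` — **the Fejér box in momentum space**: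
  `R² · T_R(ψ) = Σ_m |F_R(m)|² S_ψ(m)` for `0 < R`, `2R ≤ L` (tent identity of the Assembly file + block
  Plancherel `Literature/…/BlockPairPlancherel.lean`), with the box kernel `F_R(m) = Σ_{u∈[0,R)²} χ_m(u)`
  whose weight `|F_R(m)|²` is pinched in `[16R⁴/π⁴, R⁴]` on the ball `|q_m| ≤ π/R` and is
  `≤ 2π²R²/|q_m|²` outside (`Literature/Probability/LatticeModels/BoxKernelBounds.lean`);
* `infraredWeight_ge_of_boxSum_ge` — **box order forces infrared pair weight**: for a unit vector `ψ`,
  `0 < R`, `2R ≤ L`, `0 < ε`: `m R² ≤ T_R(ψ)/L² ⇒ Σ_{|q_m| ≤ ε} S_ψ(m) ≥ (m - 64π²/(R²ε²)) L²`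
  (off-window kernel tail + sum rule `Σ_m S_ψ(m) ≤ 32L²`);
* `boxSum_ge_of_infraredWeight_ge` — **infrared pair weight forces box order**: for any vector,
  `0 < R`, `2R ≤ L`: `Σ_{|q_m| ≤ π/R} S_ψ(m) ≥ μ L² ⇒ T_R(ψ)/L² ≥ (16μ/π⁴) R²` (main-lobe lower bound of
  the kernel);
* `mesoscopicPairOrder_iff_infraredPairWeight` — hence **`MesoscopicPairOrder` ⟺ UNIFORM INFRARED
  PAIR-WEIGHT FLOOR**: there are `U > 0`, `δ ∈ (0,1/2)` and `μ > 0` such that FOR EVERY `ε > 0`, for all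
  large even `L` and every normalised sector ground state `ψ`, the pair weight inside the infrared ball
  of radius `ε` is macroscopic: `Σ_{m : |q_m| ≤ ε} S_ψ(m) ≥ μ L²` (margins `μ = m/2`, resp.
  `m = 16μ/π⁴`). The ball INCLUDES `m = 0`; the pole half `WindowInfraredBound` bounds the PUNCTURED
  ball, `Σ_{0 < |q_m| ≤ ε} S_ψ(m) ≤ CεL²`; the summit is `S_ψ(0) ≥ aL²`. So the route's split reads, in
  one vocabulary: crux = "macroscopic pair weight at arbitrarily small momenta, uniformly over ground
  states", pole half = "none of it at NONZERO small momenta", and crux ∧ pole ⇒ summit is subtraction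
  (this is the content of the Fejér glue). For refuters: the crux fails at `(U, δ)` iff for every `μ > 0`
  some infrared ball `|q| ≤ ε` carries pair weight `< μL²` in some normalised sector ground state
  infinitely often — no scale `R` needs to be mentioned.

No definition is introduced (the floor is spelled out). Sources: T. Kennedy, E. H. Lieb, B. S. Shastry,
PRL 61 (1988) 2582 (Fourier modes of an order operator, Parseval bookkeeping) [KLS1988PRL];
E. M. Stein, R. Shakarchi, *Fourier Analysis* (2003), Ch. 2 (Fejér kernel); D. J. Scalapino, Phys. Rep.
250 (1995) 329, §2. Folklore statements.
-/

noncomputable section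

-- the summit namespace repeats the problem name by design (D-0017)
set_option linter.dupNamespace false

namespace Summit.HubbardSuperconductivity.HubbardSuperconductivity.Theorems.FunctionFieldCertificate

open Matrix Finset Filter
open Literature.Probability.LatticeModels Literature.MathematicalPhysics.QuantumLattice
open Summit.HubbardSuperconductivity.HubbardSuperconductivity.Theses.FunctionFieldCertificate
open scoped ComplexOrder ComplexConjugate

variable {L : ℕ} [NeZero L]

/-! ### The Fejér box in momentum space -/

/-- **`R² · T_R(ψ) = Σ_m |F_R(m)|² S_ψ(m)`** for `0 < R`, `2R ≤ L`: the Fejér-box pair functional of the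
crux is the `d`-wave pair structure factor summed against the box-kernel weights (tent identity
`Σ_a ‖B_a ψ‖² = R² T_R(ψ)` and block Plancherel `L² Σ_a ‖B_a ψ‖² = Σ_m |F_R(m)|² ‖Δ_d(m)ψ‖²`).
Kennedy–Lieb–Shastry, PRL 61 (1988) 2582; Stein–Shakarchi Ch. 2. [folklore] -/
theorem sq_mul_boxSum_eq_sum_boxKernel_mul_pairStructureFactor (R : ℕ) (hR : 0 < R) (hRL : 2 * R ≤ L)
    (ψ : Fock (Orb (FermionTorus 2 L))) :
    (R : ℝ) ^ 2 * (∑ x : TorusSite 2 L, ∑ y : TorusSite 2 L,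
        (∏ i : Fin 2, max 0 (1 - |(((y i - x i).valMinAbs : ℤ) : ℝ)| / (R : ℝ))) *
          (star (localPair dWaveFormFactor L x *ᵥ ψ) ⬝ᵥ (localPair dWaveFormFactor L y *ᵥ ψ)).re) =
      ∑ m : TorusSite 2 L,
        ‖∑ u : Fin 2 → Fin R, torusChar m (fun i => ((u i : ℕ) : ZMod L))‖ ^ 2 *
          pairStructureFactor dWaveFormFactor L ψ m := by
  have hLpos : (0 : ℝ) < L := Nat.cast_pos.2 (Nat.pos_of_ne_zero (NeZero.ne L))
  have hL2 : (L : ℝ) ^ 2 ≠ 0 := pow_ne_zero _ hLpos.ne'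
  -- tent identity
  rw [← FunctionFieldCertificateAssembly.re_sum_star_blockMulVec_dotProduct_eq R hR hRL
    (localPair dWaveFormFactor L) ψ]
  -- block Plancherel, read in the quadratic form of `ψ`
  have h := congrArg (fun T => (star ψ ⬝ᵥ (T *ᵥ ψ)).re)
    (sum_conjTranspose_block_mul_block (L := L) dWaveFormFactor R)
  simp only [smul_mulVec, dotProduct_smul, smul_eq_mul, sum_mulVec, dotProduct_sum,
    Complex.re_sum] at h
  rw [show ((L : ℂ) ^ 2) = (((L : ℝ) ^ 2 : ℝ) : ℂ) by push_cast; rfl, Complex.re_ofReal_mul,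
    Complex.re_sum] at h
  -- `Re (conj F · F · ⟨ψ, Δᴴ Δ ψ⟩) = |F|² · L² · S(m)`
  have hterm : ∀ m : TorusSite 2 L,
      ((conj (∑ u : Fin 2 → Fin R, torusChar m (fun i => ((u i : ℕ) : ZMod L))) *
          (∑ u : Fin 2 → Fin R, torusChar m (fun i => ((u i : ℕ) : ZMod L)))) *
        (star ψ ⬝ᵥ (((pairFieldAt dWaveFormFactor L m)ᴴ * pairFieldAt dWaveFormFactor L m) *ᵥ ψ))).re =
      ‖∑ u : Fin 2 → Fin R, torusChar m (fun i => ((u i : ℕ) : ZMod L))‖ ^ 2 *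
        ((L : ℝ) ^ 2 * pairStructureFactor dWaveFormFactor L ψ m) := by
    intro m
    rw [Complex.conj_mul', ← Complex.ofReal_pow, Complex.re_ofReal_mul, ← star_mulVec_dotProduct_mulVec,
      pairStructureFactor_apply, mul_div_cancel₀ _ hL2]
  simp only [hterm] at h
  -- divide by `L²`
  have h' : (L : ℝ) ^ 2 * (∑ a : TorusSite 2 L,
      star ((∑ u : Fin 2 → Fin R, localPair dWaveFormFactor L (a + fun i => ((u i : ℕ) : ZMod L))) *ᵥ ψ) ⬝ᵥ
        ((∑ u : Fin 2 → Fin R, localPair dWaveFormFactor L (a + fun i => ((u i : ℕ) : ZMod L))) *ᵥ ψ)).re =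
      (L : ℝ) ^ 2 * ∑ m : TorusSite 2 L,
        ‖∑ u : Fin 2 → Fin R, torusChar m (fun i => ((u i : ℕ) : ZMod L))‖ ^ 2 *
          pairStructureFactor dWaveFormFactor L ψ m := by
    rw [Complex.re_sum]
    simp_rw [star_mulVec_dotProduct_mulVec]
    rw [h, Finset.mul_sum]
    exact Finset.sum_congr rfl fun m _ => by ring
  exact mul_left_cancel₀ hL2 h'

/-! ### Box order forces infrared pair weight, and conversely -/

/-- **Box order at scale `R` forces macroscopic pair weight in every infrared ball.** For a unit vector
`ψ`, `0 < R`, `2R ≤ L`, `0 < ε`: if `m R² ≤ T_R(ψ)/L²` then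
`(m - 64π²/(R²ε²)) · L² ≤ Σ_{m : |q_m|² ≤ ε²} S_ψ(m)` — inside the ball the kernel weight is `≤ R⁴`,
outside it is `≤ 2π²R²/ε²` against the sum rule `Σ_m S_ψ(m) ≤ 32L²`.
Kennedy–Lieb–Shastry, PRL 61 (1988) 2582; Stein–Shakarchi Ch. 2. [folklore] -/
theorem infraredWeight_ge_of_boxSum_ge (R : ℕ) (hR : 0 < R) (hRL : 2 * R ≤ L) {ε m : ℝ} (hε : 0 < ε)
    (ψ : Fock (Orb (FermionTorus 2 L))) (hψ : star ψ ⬝ᵥ ψ = 1)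
    (hbox : m * (R : ℝ) ^ 2 ≤ (∑ x : TorusSite 2 L, ∑ y : TorusSite 2 L,
        (∏ i : Fin 2, max 0 (1 - |(((y i - x i).valMinAbs : ℤ) : ℝ)| / (R : ℝ))) *
          (star (localPair dWaveFormFactor L x *ᵥ ψ) ⬝ᵥ (localPair dWaveFormFactor L y *ᵥ ψ)).re) /
        (L : ℝ) ^ 2) :
    (m - 64 * Real.pi ^ 2 / ((R : ℝ) ^ 2 * ε ^ 2)) * (L : ℝ) ^ 2 ≤
      ∑ m ∈ Finset.univ.filter (fun m : TorusSite 2 L => momentumNormSq L m ≤ ε ^ 2),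
        pairStructureFactor dWaveFormFactor L ψ m := by
  classical
  have hLpos : (0 : ℝ) < L := Nat.cast_pos.2 (Nat.pos_of_ne_zero (NeZero.ne L))
  have hL2 : (0 : ℝ) < (L : ℝ) ^ 2 := by positivity
  have hRpos : (0 : ℝ) < R := Nat.cast_pos.2 hR
  have hR2 : (0 : ℝ) < (R : ℝ) ^ 2 := by positivity
  set S : TorusSite 2 L → ℝ := pairStructureFactor dWaveFormFactor L ψ with hS
  set F : TorusSite 2 L → ℝ := fun m => ‖∑ u : Fin 2 → Fin R, torusChar m (fun i => ((u i : ℕ) : ZMod L))‖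
    with hF
  set W : Finset (TorusSite 2 L) := Finset.univ.filter (fun m : TorusSite 2 L => momentumNormSq L m ≤ ε ^ 2)
    with hW
  have hSnn : ∀ m, 0 ≤ S m := fun m => pairStructureFactor_nonneg _ _ _ _
  -- `R² T_R = Σ |F|² S`
  have hid := sq_mul_boxSum_eq_sum_boxKernel_mul_pairStructureFactor R hR hRL ψ
  rw [le_div_iff₀ hL2] at hbox
  have hmain : m * (R : ℝ) ^ 2 * (L : ℝ) ^ 2 * (R : ℝ) ^ 2 ≤ ∑ m, F m ^ 2 * S m := by
    calc _ = (R : ℝ) ^ 2 * (m * (R : ℝ) ^ 2 * (L : ℝ) ^ 2) := by ring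
      _ ≤ _ := mul_le_mul_of_nonneg_left hbox hR2.le
      _ = ∑ m, F m ^ 2 * S m := hid
  -- kernel bounds
  have hFle : ∀ m, F m ^ 2 ≤ (R : ℝ) ^ 4 := fun m => by
    rw [show (R : ℝ) ^ 4 = ((R : ℝ) ^ 2) ^ 2 by ring]
    exact pow_le_pow_left₀ (norm_nonneg _) (norm_boxKernel_le (d := 2) m R) 2
  have hFoff : ∀ m, ε ^ 2 < momentumNormSq L m → F m ^ 2 ≤ 2 * Real.pi ^ 2 * (R : ℝ) ^ 2 / ε ^ 2 := by
    intro m hm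
    have hq : 0 < momentumNormSq L m := lt_trans (by positivity) hm
    have hk := norm_boxKernel_sq_mul_le (L := L) m R
    rw [← momentumNormSq_apply] at hk
    rw [le_div_iff₀ (by positivity)]
    calc F m ^ 2 * ε ^ 2 ≤ F m ^ 2 * momentumNormSq L m :=
          mul_le_mul_of_nonneg_left hm.le (sq_nonneg _)
      _ ≤ 2 * Real.pi ^ 2 * (R : ℝ) ^ 2 := hk
  -- split the momentum sum
  have hsplit : ∑ m, F m ^ 2 * S m ≤ (R : ℝ) ^ 4 * ∑ m ∈ W, S m +
      2 * Real.pi ^ 2 * (R : ℝ) ^ 2 / ε ^ 2 * ∑ m, S m := by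
    have hpt : ∀ m ∈ (Finset.univ : Finset (TorusSite 2 L)), F m ^ 2 * S m ≤
        (if m ∈ W then (R : ℝ) ^ 4 * S m else 0) + 2 * Real.pi ^ 2 * (R : ℝ) ^ 2 / ε ^ 2 * S m := by
      intro m _
      have hc : 0 ≤ 2 * Real.pi ^ 2 * (R : ℝ) ^ 2 / ε ^ 2 * S m := mul_nonneg (by positivity) (hSnn m)
      by_cases hm : m ∈ W
      · rw [if_pos hm]
        have := mul_le_mul_of_nonneg_right (hFle m) (hSnn m)
        linarith
      · rw [if_neg hm, zero_add]
        have hq : ε ^ 2 < momentumNormSq L m := by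
          rw [hW, Finset.mem_filter] at hm
          push Not at hm
          exact hm (Finset.mem_univ m)
        exact mul_le_mul_of_nonneg_right (hFoff m hq) (hSnn m)
    refine (Finset.sum_le_sum hpt).trans (le_of_eq ?_)
    rw [Finset.sum_add_distrib, Fintype.sum_ite_mem, ← Finset.mul_sum, ← Finset.mul_sum]
  have hsum : ∑ m, S m ≤ 32 * (L : ℝ) ^ 2 := wib_sum_pairStructureFactor_le L ψ hψ
  -- assemble: `m R⁴ L² ≤ R⁴ W + 64 π² R² L²/ε²`
  have key : m * (R : ℝ) ^ 2 * (L : ℝ) ^ 2 * (R : ℝ) ^ 2 ≤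
      (R : ℝ) ^ 4 * ∑ m ∈ W, S m + 2 * Real.pi ^ 2 * (R : ℝ) ^ 2 / ε ^ 2 * (32 * (L : ℝ) ^ 2) := by
    refine hmain.trans (hsplit.trans ?_)
    have := mul_le_mul_of_nonneg_left hsum
      (show (0 : ℝ) ≤ 2 * Real.pi ^ 2 * (R : ℝ) ^ 2 / ε ^ 2 by positivity)
    linarith
  have hR4 : (0 : ℝ) < (R : ℝ) ^ 4 := by positivity
  have key' : (R : ℝ) ^ 4 * ((m - 64 * Real.pi ^ 2 / ((R : ℝ) ^ 2 * ε ^ 2)) * (L : ℝ) ^ 2) ≤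
      (R : ℝ) ^ 4 * ∑ m ∈ W, S m := by
    have e : (R : ℝ) ^ 4 * ((m - 64 * Real.pi ^ 2 / ((R : ℝ) ^ 2 * ε ^ 2)) * (L : ℝ) ^ 2) =
        m * (R : ℝ) ^ 2 * (L : ℝ) ^ 2 * (R : ℝ) ^ 2 -
          2 * Real.pi ^ 2 * (R : ℝ) ^ 2 / ε ^ 2 * (32 * (L : ℝ) ^ 2) := by
      field_simp
      ring
    rw [e]
    linarith
  exact le_of_mul_le_mul_left key' hR4

/-- **Macroscopic pair weight in the ball of radius `π/R` forces box order at scale `R`.** For any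
vector `ψ`, `0 < R`, `2R ≤ L`: if `μ L² ≤ Σ_{m : |q_m|² ≤ (π/R)²} S_ψ(m)` then
`(16μ/π⁴) R² ≤ T_R(ψ)/L²` — on that ball the kernel weight is `≥ 16R⁴/π⁴` (`norm_boxKernel_sq_ge`),
and all other terms of `R² T_R = Σ_m |F_R(m)|² S_ψ(m)` are nonnegative.
Zygmund, *Trigonometric Series* I, Ch. II §6; Kennedy–Lieb–Shastry (1988). [folklore] -/
theorem boxSum_ge_of_infraredWeight_ge (R : ℕ) (hR : 0 < R) (hRL : 2 * R ≤ L) {μ : ℝ}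
    (ψ : Fock (Orb (FermionTorus 2 L)))
    (hW : μ * (L : ℝ) ^ 2 ≤
      ∑ m ∈ Finset.univ.filter (fun m : TorusSite 2 L => momentumNormSq L m ≤ (Real.pi / R) ^ 2),
        pairStructureFactor dWaveFormFactor L ψ m) :
    16 * μ / Real.pi ^ 4 * (R : ℝ) ^ 2 ≤ (∑ x : TorusSite 2 L, ∑ y : TorusSite 2 L,
        (∏ i : Fin 2, max 0 (1 - |(((y i - x i).valMinAbs : ℤ) : ℝ)| / (R : ℝ))) *
          (star (localPair dWaveFormFactor L x *ᵥ ψ) ⬝ᵥ (localPair dWaveFormFactor L y *ᵥ ψ)).re) /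
        (L : ℝ) ^ 2 := by
  classical
  have hLpos : (0 : ℝ) < L := Nat.cast_pos.2 (Nat.pos_of_ne_zero (NeZero.ne L))
  have hL2 : (0 : ℝ) < (L : ℝ) ^ 2 := by positivity
  have hRpos : (0 : ℝ) < R := Nat.cast_pos.2 hR
  have hR2 : (0 : ℝ) < (R : ℝ) ^ 2 := by positivity
  have hπ : 0 < Real.pi := Real.pi_pos
  set S : TorusSite 2 L → ℝ := pairStructureFactor dWaveFormFactor L ψ with hS
  set F : TorusSite 2 L → ℝ := fun m => ‖∑ u : Fin 2 → Fin R, torusChar m (fun i => ((u i : ℕ) : ZMod L))‖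
    with hF
  set W : Finset (TorusSite 2 L) :=
    Finset.univ.filter (fun m : TorusSite 2 L => momentumNormSq L m ≤ (Real.pi / R) ^ 2) with hWdef
  have hSnn : ∀ m, 0 ≤ S m := fun m => pairStructureFactor_nonneg _ _ _ _
  have hid := sq_mul_boxSum_eq_sum_boxKernel_mul_pairStructureFactor R hR hRL ψ
  -- main-lobe lower bound on the window
  have hFge : ∀ m ∈ W, 16 * (R : ℝ) ^ 4 / Real.pi ^ 4 ≤ F m ^ 2 := by
    intro m hm
    rw [hWdef, Finset.mem_filter] at hm
    refine norm_boxKernel_sq_ge (L := L) m R ?_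
    rw [← momentumNormSq_apply]
    calc (R : ℝ) ^ 2 * momentumNormSq L m ≤ (R : ℝ) ^ 2 * (Real.pi / R) ^ 2 :=
          mul_le_mul_of_nonneg_left hm.2 hR2.le
      _ = Real.pi ^ 2 := by field_simp
  -- `Σ_m |F|² S ≥ Σ_W |F|² S ≥ (16R⁴/π⁴) Σ_W S ≥ (16R⁴/π⁴) μ L²`
  have h1 : ∑ m ∈ W, F m ^ 2 * S m ≤ ∑ m, F m ^ 2 * S m :=
    Finset.sum_le_univ_sum_of_nonneg fun m => mul_nonneg (sq_nonneg _) (hSnn m)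
  have h2 : 16 * (R : ℝ) ^ 4 / Real.pi ^ 4 * ∑ m ∈ W, S m ≤ ∑ m ∈ W, F m ^ 2 * S m := by
    rw [Finset.mul_sum]
    exact Finset.sum_le_sum fun m hm => mul_le_mul_of_nonneg_right (hFge m hm) (hSnn m)
  have h3 : 16 * (R : ℝ) ^ 4 / Real.pi ^ 4 * (μ * (L : ℝ) ^ 2) ≤
      16 * (R : ℝ) ^ 4 / Real.pi ^ 4 * ∑ m ∈ W, S m :=
    mul_le_mul_of_nonneg_left hW (by positivity)
  have key : (R : ℝ) ^ 2 * (16 * μ / Real.pi ^ 4 * (R : ℝ) ^ 2 * (L : ℝ) ^ 2) ≤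
      (R : ℝ) ^ 2 * (∑ x : TorusSite 2 L, ∑ y : TorusSite 2 L,
        (∏ i : Fin 2, max 0 (1 - |(((y i - x i).valMinAbs : ℤ) : ℝ)| / (R : ℝ))) *
          (star (localPair dWaveFormFactor L x *ᵥ ψ) ⬝ᵥ (localPair dWaveFormFactor L y *ᵥ ψ)).re) := by
    rw [hid]
    calc _ = 16 * (R : ℝ) ^ 4 / Real.pi ^ 4 * (μ * (L : ℝ) ^ 2) := by ring
      _ ≤ _ := h3.trans (h2.trans h1)
  rw [le_div_iff₀ hL2]
  exact le_of_mul_le_mul_left key hR2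

/-! ### The crux is a uniform infrared pair-weight floor -/

/-- **`MesoscopicPairOrder` ⟺ uniform infrared pair-weight floor.** The route's pole-free crux (Fejér-box
`d`-wave pair order `m R²` at arbitrarily large scales `R`, in every normalised `(N_L, S^z = 0)`-sector
ground state of `hubbardTorus 2 L 1 U` on all large even tori, at one `(U, δ)`) holds iff at some
`U > 0`, `δ ∈ (0, 1/2)` there is `μ > 0` such that for EVERY `ε > 0`, all large even `L` and every
normalised sector ground state `ψ`, the pair weight in the infrared ball of radius `ε` is macroscopic:
`μ L² ≤ Σ_{m : |q_m|² ≤ ε²} S_ψ(m)` (`S_ψ = pairStructureFactor dWaveFormFactor L ψ`, the vocabulary of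
crux `WindowInfraredBound`). Forward with `μ = m/2` at the scale `R ≥ ⌈128π²/(mε²)⌉ + 1` the crux
supplies (`infraredWeight_ge_of_boxSum_ge`); backward with `m = 16μ/π⁴` at EVERY scale `R ≥ 1`, reading
the floor at `ε = π/R` (`boxSum_ge_of_infraredWeight_ge`). The ball includes `m = 0`: the pole half
bounds the punctured ball by `CεL²`, the summit asks `S_ψ(0) ≥ aL²`, and the route's Assembly is the
subtraction of the two. Kennedy–Lieb–Shastry, PRL 61 (1988) 2582; Stein–Shakarchi Ch. 2. [folklore] -/
theorem mesoscopicPairOrder_iff_infraredPairWeight :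
    MesoscopicPairOrder ↔
      ∃ U : ℝ, 0 < U ∧ ∃ δ ∈ Set.Ioo (0:ℝ) (1 / 2), ∃ μ : ℝ, 0 < μ ∧ ∀ ε : ℝ, 0 < ε →
        ∃ L₀ : ℕ, ∀ (L : ℕ) [NeZero L], L₀ ≤ L → Even L →
          ∀ ψ : Fock (Orb (FermionTorus 2 L)), star ψ ⬝ᵥ ψ = 1 →
            IsGroundStateInSector (hubbardTorus 2 L 1 U) (2 * ⌊(1 - δ) * (L : ℝ) ^ 2 / 2⌋₊) 0 ψ →
              μ * (L : ℝ) ^ 2 ≤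
                ∑ m ∈ Finset.univ.filter (fun m : TorusSite 2 L => momentumNormSq L m ≤ ε ^ 2),
                  pairStructureFactor dWaveFormFactor L ψ m := by
  constructor
  · rintro ⟨U, hU, δ, hδ, m, hm, hall⟩
    refine ⟨U, hU, δ, hδ, m / 2, by positivity, fun ε hε => ?_⟩
    -- the scale: `R ≥ R₀ = ⌈128π²/(mε²)⌉ + 1`, so that `64π²/(R²ε²) ≤ m/2`
    obtain ⟨R, hR₀, L₀, hL⟩ := hall (⌈128 * Real.pi ^ 2 / (m * ε ^ 2)⌉₊ + 1)
    have hR1 : 1 ≤ R := le_trans (Nat.le_add_left 1 _) hR₀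
    have hRpos : 0 < R := hR1
    have hRreal : (1 : ℝ) ≤ R := by exact_mod_cast hR1
    have hRge : 128 * Real.pi ^ 2 / (m * ε ^ 2) ≤ (R : ℝ) := by
      have h1 : 128 * Real.pi ^ 2 / (m * ε ^ 2) ≤ (⌈128 * Real.pi ^ 2 / (m * ε ^ 2)⌉₊ : ℝ) :=
        Nat.le_ceil _
      have h2 : (⌈128 * Real.pi ^ 2 / (m * ε ^ 2)⌉₊ : ℝ) + 1 ≤ (R : ℝ) := by exact_mod_cast hR₀
      linarith
    have htail : 64 * Real.pi ^ 2 / ((R : ℝ) ^ 2 * ε ^ 2) ≤ m / 2 := by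
      have hRR : (R : ℝ) ≤ (R : ℝ) ^ 2 := by nlinarith
      have hmε : 0 < m * ε ^ 2 := by positivity
      rw [div_le_iff₀ hmε] at hRge
      rw [div_le_iff₀ (by positivity)]
      nlinarith
    refine ⟨max L₀ (2 * R), ?_⟩
    intro L _ hLL hE ψ hψ hgs
    have hLL₀ : L₀ ≤ L := le_of_max_le_left hLL
    have h2R : 2 * R ≤ L := le_of_max_le_right hLL
    have hbody := hL L hLL₀ hE ψ hψ hgs
    have hfloor := infraredWeight_ge_of_boxSum_ge R hRpos h2R hε ψ hψ hbody
    have hLpos : (0 : ℝ) < L := Nat.cast_pos.2 (Nat.pos_of_ne_zero (NeZero.ne L))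
    have hL2 : (0 : ℝ) ≤ (L : ℝ) ^ 2 := by positivity
    have : m / 2 * (L : ℝ) ^ 2 ≤ (m - 64 * Real.pi ^ 2 / ((R : ℝ) ^ 2 * ε ^ 2)) * (L : ℝ) ^ 2 :=
      mul_le_mul_of_nonneg_right (by linarith) hL2
    exact this.trans hfloor
  · rintro ⟨U, hU, δ, hδ, μ, hμ, hall⟩
    have hπ : 0 < Real.pi := Real.pi_pos
    refine ⟨U, hU, δ, hδ, 16 * μ / Real.pi ^ 4, by positivity, fun R₀ => ?_⟩
    set R : ℕ := max R₀ 1 with hRdef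
    have hR1 : 1 ≤ R := le_max_right _ _
    have hRpos : 0 < R := hR1
    have hRreal : (0 : ℝ) < R := Nat.cast_pos.2 hRpos
    obtain ⟨L₀, hL⟩ := hall (Real.pi / R) (by positivity)
    refine ⟨R, le_max_left _ _, max L₀ (2 * R), ?_⟩
    intro L _ hLL hE ψ hψ hgs
    have hLL₀ : L₀ ≤ L := le_of_max_le_left hLL
    have h2R : 2 * R ≤ L := le_of_max_le_right hLL
    have hfloor := hL L hLL₀ hE ψ hψ hgs
    exact boxSum_ge_of_infraredWeight_ge R hRpos h2R ψ hfloor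

/-- **Registered form** (sub-goal `mesoscopicPairOrderIffInfraredPairWeight` of item
`stmt-HubbardSuperconductivity-7331`, line `Sketch`, lead c4). [folklore] -/
theorem mesoscopicPairOrderIffInfraredPairWeight : Summit.HubbardSuperconductivity.HubbardSuperconductivity.Theses.FunctionFieldCertificate.MesoscopicPairOrder ↔ ∃ U : ℝ, 0 < U ∧ ∃ δ ∈ Set.Ioo (0:ℝ) (1 / 2), ∃ μ : ℝ, 0 < μ ∧ ∀ ε : ℝ, 0 < ε → ∃ L₀ : ℕ, ∀ (L : ℕ) [NeZero L], L₀ ≤ L → Even L → ∀ ψ : Fock (Orb (FermionTorus 2 L)), star ψ ⬝ᵥ ψ = 1 → IsGroundStateInSector (hubbardTorus 2 L 1 U) (2 * ⌊(1 - δ) * (L : ℝ) ^ 2 / 2⌋₊) 0 ψ → μ * (L : ℝ) ^ 2 ≤ ∑ m ∈ Finset.univ.filter (fun m : TorusSite 2 L => momentumNormSq L m ≤ ε ^ 2), pairStructureFactor dWaveFormFactor L ψ m :=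
  mesoscopicPairOrder_iff_infraredPairWeight

/-! ### Pointwise form (fixed `(U, δ)`), for the negative side -/

/-- **Pointwise form of the equivalence** (fixed coupling `U` and filling `δ`; no positivity of `U`
needed): the crux BODY at `(U, δ)` holds iff there is `μ > 0` such that for every `ε > 0`, all large
even `L` and every normalised `(2⌊(1-δ)L²/2⌋, 0)`-sector ground state `ψ` of `hubbardTorus 2 L 1 U`,
`μ L² ≤ Σ_{m : |q_m|² ≤ ε²} S_ψ(m)`. Hence the refuter's interface at `(U, δ)` in momentum language: the
body fails iff for every `μ > 0` there is an `ε > 0` such that, infinitely often in even `L`, some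
normalised sector ground state has infrared pair weight `Σ_{|q_m| ≤ ε} S_ψ(m) < μ L²` (compare the
sibling crux `WindowInfraredBound`, which bounds the punctured window from above). Same proof as
`mesoscopicPairOrder_iff_infraredPairWeight`. [folklore] -/
theorem mesoscopicPairOrderAt_iff_infraredPairWeightAt : ∀ (U δ : ℝ), ((∃ m : ℝ, 0 < m ∧ ∀ R₀ : ℕ, ∃ R : ℕ, R₀ ≤ R ∧ ∃ L₀ : ℕ, ∀ (L : ℕ) [NeZero L], L₀ ≤ L → Even L → ∀ ψ : Fock (Orb (FermionTorus 2 L)), star ψ ⬝ᵥ ψ = 1 → IsGroundStateInSector (hubbardTorus 2 L 1 U) (2 * ⌊(1 - δ) * (L : ℝ) ^ 2 / 2⌋₊) 0 ψ → m * (R : ℝ) ^ 2 ≤ (∑ x : TorusSite 2 L, ∑ y : TorusSite 2 L, (∏ i : Fin 2, max 0 (1 - |(((y i - x i).valMinAbs : ℤ) : ℝ)| / (R : ℝ))) * (star (localPair dWaveFormFactor L x *ᵥ ψ) ⬝ᵥ (localPair dWaveFormFactor L y *ᵥ ψ)).re) / (L : ℝ) ^ 2) ↔ ∃ μ : ℝ,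 0 < μ ∧ ∀ ε : ℝ, 0 < ε → ∃ L₀ : ℕ, ∀ (L : ℕ) [NeZero L], L₀ ≤ L → Even L → ∀ ψ : Fock (Orb (FermionTorus 2 L)), star ψ ⬝ᵥ ψ = 1 → IsGroundStateInSector (hubbardTorus 2 L 1 U) (2 * ⌊(1 - δ) * (L : ℝ) ^ 2 / 2⌋₊) 0 ψ → μ * (L : ℝ) ^ 2 ≤ ∑ m ∈ Finset.univ.filter (fun m : TorusSite 2 L => momentumNormSq L m ≤ ε ^ 2), pairStructureFactor dWaveFormFactor L ψ m) := by
  intro U δ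
  constructor
  · rintro ⟨m, hm, hall⟩
    refine ⟨m / 2, by positivity, fun ε hε => ?_⟩
    obtain ⟨R, hR₀, L₀, hL⟩ := hall (⌈128 * Real.pi ^ 2 / (m * ε ^ 2)⌉₊ + 1)
    have hR1 : 1 ≤ R := le_trans (Nat.le_add_left 1 _) hR₀
    have hRpos : 0 < R := hR1
    have hRreal : (1 : ℝ) ≤ R := by exact_mod_cast hR1
    have hRge : 128 * Real.pi ^ 2 / (m * ε ^ 2) ≤ (R : ℝ) := by
      have h1 : 128 * Real.pi ^ 2 / (m * ε ^ 2) ≤ (⌈128 * Real.pi ^ 2 / (m * ε ^ 2)⌉₊ : ℝ) :=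
        Nat.le_ceil _
      have h2 : (⌈128 * Real.pi ^ 2 / (m * ε ^ 2)⌉₊ : ℝ) + 1 ≤ (R : ℝ) := by exact_mod_cast hR₀
      linarith
    have htail : 64 * Real.pi ^ 2 / ((R : ℝ) ^ 2 * ε ^ 2) ≤ m / 2 := by
      have hRR : (R : ℝ) ≤ (R : ℝ) ^ 2 := by nlinarith
      have hmε : 0 < m * ε ^ 2 := by positivity
      rw [div_le_iff₀ hmε] at hRge
      rw [div_le_iff₀ (by positivity)]
      nlinarith
    refine ⟨max L₀ (2 * R), ?_⟩
    intro L _ hLL hE ψ hψ hgs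
    have hbody := hL L (le_of_max_le_left hLL) hE ψ hψ hgs
    have hfloor := infraredWeight_ge_of_boxSum_ge R hRpos (le_of_max_le_right hLL) hε ψ hψ hbody
    have hLpos : (0 : ℝ) < L := Nat.cast_pos.2 (Nat.pos_of_ne_zero (NeZero.ne L))
    have hL2 : (0 : ℝ) ≤ (L : ℝ) ^ 2 := by positivity
    have : m / 2 * (L : ℝ) ^ 2 ≤ (m - 64 * Real.pi ^ 2 / ((R : ℝ) ^ 2 * ε ^ 2)) * (L : ℝ) ^ 2 :=
      mul_le_mul_of_nonneg_right (by linarith) hL2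
    exact this.trans hfloor
  · rintro ⟨μ, hμ, hall⟩
    have hπ : 0 < Real.pi := Real.pi_pos
    refine ⟨16 * μ / Real.pi ^ 4, by positivity, fun R₀ => ?_⟩
    set R : ℕ := max R₀ 1 with hRdef
    have hR1 : 1 ≤ R := le_max_right _ _
    have hRpos : 0 < R := hR1
    have hRreal : (0 : ℝ) < R := Nat.cast_pos.2 hRpos
    obtain ⟨L₀, hL⟩ := hall (Real.pi / R) (by positivity)
    refine ⟨R, le_max_left _ _, max L₀ (2 * R), ?_⟩
    intro L _ hLL hE ψ hψ hgs
    have hfloor := hL L (le_of_max_le_left hLL) hE ψ hψ hgs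
    exact boxSum_ge_of_infraredWeight_ge R hRpos (le_of_max_le_right hLL) ψ hfloor

end Summit.HubbardSuperconductivity.HubbardSuperconductivity.Theorems.FunctionFieldCertificate
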